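import Mathlib.Analysis.SpecialFunctions.Trigonometric.InverseDeriv
import Mathlib.Analysis.SpecialFunctions.Trigonometric.Arctan
import Mathlib.Analysis.SpecialFunctions.Trigonometric.Complex
import Mathlib.Analysis.Convex.Deriv
import HarnessLib

/-!
# The polar contraction of Böröczky–Szabó: `d(Cx, Cy) ≥ λ · d(x, y)` — proved

HONEST FRAMING. Part of the venture `Summits/Ventures/Crystal3D` (cell `pub-crystal3d`, phase 2,
24-hour decision sprint; seat typer-bulk; cell files `phase2/theory1/RANGE-CUT.md` §1–§2 (theory-1;
re-derived by theory-2, `SCORE-DESIGN.md` §20.1 = `TARGET-GAP.md` (U1)/P-L5′) and idea-2's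
`TAMMES-BRIDGE.md` Part A). The EXCHANGE RATE between thirteen-point sphere-code bounds and hole
radii (`Bulk/SphereCodeCut.lean`) rests on one lemma: contracting polar angles about a pole by a
factor `λ ∈ [0, 1]` (azimuths fixed) multiplies every spherical distance by AT LEAST `λ`. This file
PROVES it by the calculus route (no curve lengths, no certificate, no `native_decide`):

* `T λ u := cos (λ · arccos u)` is CONCAVE on `[-1, 1]` (`concaveOn_T`): on `(-1, 1)` its
  derivative is `λ · φ(arccos u)` with `φ(θ) = sin(λθ)/sin θ` (`hasDerivAt_T`), and `φ` is monotone
  on `(0, π)` (`monotoneOn_phiAux`) because `φ' = g/sin²` with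
  `g(θ) = λ cos(λθ) sin θ − sin(λθ) cos θ`, `g(0) = 0`, `g' = (1 − λ²) sin(λθ) sin θ ≥ 0`
  (`hasDerivAt_gAux`, `gAux_nonneg`);
* THE CONTRACTION INEQUALITY (`inner_contract_le`): for polar angles `θ₁, θ₂ ∈ [0, π]`, a
  longitude cosine `c ∈ [-1, 1]` and `0 ≤ λ ≤ 1`,
  `cos λθ₁ cos λθ₂ + sin λθ₁ sin λθ₂ · c ≤ T λ (cos θ₁ cos θ₂ + sin θ₁ sin θ₂ · c)` — the left side
  is affine in `c`, the right side concave in `c`, and the two agree (resp. compare) at `c = 1`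
  (`T_cos_sub`) and `c = −1` (`cos_add_le_T`, where `λ ≤ 1` enters when `θ₁ + θ₂ > π`);
* the half-angle-tangent dictionary used downstream (`one_sub_tan_sq`, `two_mul_tan`:
  `1 − tan²b = cos 2b (1 + tan²b)`, `2 tan b = sin 2b (1 + tan²b)`), the contraction as a profile
  `contractProfile λ w = tan (λ · arctan w)` (`w = tan(θ/2) ↦ tan(λθ/2)`), and `arccos (1/2) = π/3`.

Pure Mathlib real analysis; nothing about spheres or packings is stated here.
-/

noncomputable section

open Real Set

namespace Summit.Ventures.Crystal3D.PolarContraction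


/-- `g λ θ = λ cos(λθ) sin θ − sin(λθ) cos θ`, the numerator of the derivative of
`θ ↦ sin(λθ)/sin θ`. -/
def gAux (lam θ : ℝ) : ℝ := lam * cos (lam * θ) * sin θ - sin (lam * θ) * cos θ

/-- `g' = (1 − λ²) sin(λθ) sin θ`. -/
theorem hasDerivAt_gAux (lam θ : ℝ) :
    HasDerivAt (gAux lam) ((1 - lam ^ 2) * sin (lam * θ) * sin θ) θ := by
  have h1 : HasDerivAt (fun θ => lam * θ) lam θ := by
    simpa using (hasDerivAt_id θ).const_mul lam
  have hc : HasDerivAt (fun θ => cos (lam * θ)) (-sin (lam * θ) * lam) θ := h1.cos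
  have hs : HasDerivAt (fun θ => sin (lam * θ)) (cos (lam * θ) * lam) θ := h1.sin
  have hA : HasDerivAt (fun θ => lam * cos (lam * θ) * sin θ)
      (lam * (-sin (lam * θ) * lam) * sin θ + lam * cos (lam * θ) * cos θ) θ := by
    exact (hc.const_mul lam).mul (hasDerivAt_sin θ)
  have hB : HasDerivAt (fun θ => sin (lam * θ) * cos θ)
      (cos (lam * θ) * lam * cos θ + sin (lam * θ) * -sin θ) θ :=
    hs.mul (hasDerivAt_cos θ)
  have h := hA.sub hB
  have heq : lam * (-sin (lam * θ) * lam) * sin θ + lam * cos (lam * θ) * cos θ -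
      (cos (lam * θ) * lam * cos θ + sin (lam * θ) * -sin θ) =
      (1 - lam ^ 2) * sin (lam * θ) * sin θ := by ring
  rw [heq] at h
  exact h

/-- `g ≥ 0` on `[0, π]` for `0 ≤ λ ≤ 1` (`g(0) = 0`, `g' ≥ 0` there). -/
theorem gAux_nonneg {lam : ℝ} (h0 : 0 ≤ lam) (h1 : lam ≤ 1) {θ : ℝ} (hθ0 : 0 ≤ θ) (hθπ : θ ≤ π) :
    0 ≤ gAux lam θ := by
  have hmono : MonotoneOn (gAux lam) (Icc 0 π) := by
    apply monotoneOn_of_deriv_nonneg (convex_Icc 0 π)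
    · exact fun x _ => (hasDerivAt_gAux lam x).continuousAt.continuousWithinAt
    · exact fun x _ => (hasDerivAt_gAux lam x).differentiableAt.differentiableWithinAt
    · intro x hx
      rw [interior_Icc] at hx
      rw [(hasDerivAt_gAux lam x).deriv]
      have hx0 : 0 ≤ x := hx.1.le
      have hxπ : x ≤ π := hx.2.le
      have hs1 : 0 ≤ sin (lam * x) :=
        sin_nonneg_of_nonneg_of_le_pi (mul_nonneg h0 hx0)
          ((mul_le_of_le_one_left hx0 h1).trans hxπ)
      have hs2 : 0 ≤ sin x := sin_nonneg_of_nonneg_of_le_pi hx0 hxπ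
      have hl : 0 ≤ 1 - lam ^ 2 := by nlinarith
      positivity
  have h0' : gAux lam 0 = 0 := by simp [gAux]
  have := hmono (left_mem_Icc.2 pi_pos.le) ⟨hθ0, hθπ⟩ hθ0
  rwa [h0'] at this

/-- `φ λ θ = sin(λθ)/sin θ`. -/
def phiAux (lam θ : ℝ) : ℝ := sin (lam * θ) / sin θ

/-- `φ' = g / sin² θ` where `sin θ ≠ 0`. -/
theorem hasDerivAt_phiAux (lam : ℝ) {θ : ℝ} (hθ : sin θ ≠ 0) :
    HasDerivAt (phiAux lam) (gAux lam θ / sin θ ^ 2) θ := by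
  have h1 : HasDerivAt (fun θ => lam * θ) lam θ := by
    simpa using (hasDerivAt_id θ).const_mul lam
  have hs : HasDerivAt (fun θ => sin (lam * θ)) (cos (lam * θ) * lam) θ := h1.sin
  have h := hs.div (hasDerivAt_sin θ) hθ
  have heq : (cos (lam * θ) * lam * sin θ - sin (lam * θ) * cos θ) / sin θ ^ 2 =
      gAux lam θ / sin θ ^ 2 := by
    simp only [gAux]; ring
  rw [heq] at h
  exact h

/-- `θ ↦ sin(λθ)/sin θ` is MONOTONE on `(0, π)` for `0 ≤ λ ≤ 1`. -/
theorem monotoneOn_phiAux {lam : ℝ} (h0 : 0 ≤ lam) (h1 : lam ≤ 1) :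
    MonotoneOn (phiAux lam) (Ioo 0 π) := by
  have hsin : ∀ x ∈ Ioo 0 π, sin x ≠ 0 := fun x hx => (sin_pos_of_pos_of_lt_pi hx.1 hx.2).ne'
  apply monotoneOn_of_deriv_nonneg (convex_Ioo 0 π)
  · exact fun x hx => (hasDerivAt_phiAux lam (hsin x hx)).continuousAt.continuousWithinAt
  · intro x hx
    rw [interior_Ioo] at hx
    exact (hasDerivAt_phiAux lam (hsin x hx)).differentiableAt.differentiableWithinAt
  · intro x hx
    rw [interior_Ioo] at hx
    rw [(hasDerivAt_phiAux lam (hsin x hx)).deriv]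
    exact div_nonneg (gAux_nonneg h0 h1 hx.1.le hx.2.le) (sq_nonneg _)

/-- `T λ u = cos (λ · arccos u)`: the cosine of the contracted angle as a function of the cosine
of the angle. -/
def T (lam u : ℝ) : ℝ := cos (lam * arccos u)

/-- `T` is continuous. -/
theorem continuous_T (lam : ℝ) : Continuous (T lam) :=
  continuous_cos.comp (continuous_const.mul continuous_arccos)

/-- On `(-1, 1)`, `T' = λ · φ(arccos u)` (`= λ sin(λ arccos u)/ sin(arccos u)`). -/
theorem hasDerivAt_T (lam : ℝ) {u : ℝ} (hu1 : -1 < u) (hu2 : u < 1) :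
    HasDerivAt (T lam) (lam * phiAux lam (arccos u)) u := by
  have ha : HasDerivAt arccos (-(1 / Real.sqrt (1 - u ^ 2))) u :=
    hasDerivAt_arccos hu1.ne' hu2.ne
  have hm : HasDerivAt (fun u => lam * arccos u) (lam * -(1 / Real.sqrt (1 - u ^ 2))) u :=
    ha.const_mul lam
  have h := hm.cos
  have hsin : sin (arccos u) = Real.sqrt (1 - u ^ 2) := sin_arccos u
  have heq : -sin (lam * arccos u) * (lam * -(1 / Real.sqrt (1 - u ^ 2))) =
      lam * phiAux lam (arccos u) := by
    simp only [phiAux, hsin]; ring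
  rw [heq] at h
  exact h

/-- **`T λ` is CONCAVE on `[-1, 1]`** for `0 ≤ λ ≤ 1` (idea-2 / theory-1, RANGE-CUT.md §2 (i)). -/
theorem concaveOn_T {lam : ℝ} (h0 : 0 ≤ lam) (h1 : lam ≤ 1) : ConcaveOn ℝ (Icc (-1) 1) (T lam) := by
  apply AntitoneOn.concaveOn_of_deriv (convex_Icc (-1) 1) (continuous_T lam).continuousOn
  · intro u hu
    rw [interior_Icc] at hu
    exact (hasDerivAt_T lam hu.1 hu.2).differentiableAt.differentiableWithinAt
  · intro u hu v hv huv
    rw [interior_Icc] at hu hv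
    rw [(hasDerivAt_T lam hu.1 hu.2).deriv, (hasDerivAt_T lam hv.1 hv.2).deriv]
    have hau : arccos u ∈ Ioo 0 π := ⟨arccos_pos.2 hu.2, arccos_lt_pi.2 hu.1⟩
    have hav : arccos v ∈ Ioo 0 π := ⟨arccos_pos.2 hv.2, arccos_lt_pi.2 hv.1⟩
    exact mul_le_mul_of_nonneg_left (monotoneOn_phiAux h0 h1 hav hau (arccos_le_arccos huv)) h0

/-! ## The contraction inequality -/

/-- `cos α ≤ cos β` whenever `0 ≤ β ≤ α` and `α + β ≤ 2π` (cosine is symmetric about `π`). -/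
theorem cos_le_cos_of_le_of_add_le {α β : ℝ} (hβ : 0 ≤ β) (hβα : β ≤ α) (hsum : α + β ≤ 2 * π) :
    cos α ≤ cos β := by
  by_cases hα : α ≤ π
  · exact cos_le_cos_of_nonneg_of_le_pi hβ hα hβα
  · push Not at hα
    have h2 : cos α = cos (2 * π - α) := by
      rw [cos_sub, cos_two_pi, sin_two_pi]; ring
    rw [h2]
    exact cos_le_cos_of_nonneg_of_le_pi hβ (by linarith) (by linarith)

/-- At `c = 1`: `T λ (cos (θ₁ − θ₂)) = cos (λ(θ₁ − θ₂))` for `θ₁, θ₂ ∈ [0, π]`. -/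
theorem T_cos_sub {lam θ₁ θ₂ : ℝ} (hθ₁ : θ₁ ∈ Icc 0 π) (hθ₂ : θ₂ ∈ Icc 0 π) :
    T lam (cos (θ₁ - θ₂)) = cos (lam * θ₁ - lam * θ₂) := by
  simp only [T]
  rw [← cos_abs (θ₁ - θ₂), arccos_cos (abs_nonneg _)
    (abs_sub_le_iff.2 ⟨by linarith [hθ₁.2, hθ₂.1], by linarith [hθ₁.1, hθ₂.2]⟩)]
  rw [← mul_sub, ← cos_abs (lam * (θ₁ - θ₂))]
  by_cases hl : 0 ≤ lam
  · rw [abs_mul, abs_of_nonneg hl]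
  · push Not at hl
    rw [abs_mul, abs_of_neg hl, ← cos_neg]; ring_nf

/-- At `c = −1`: `cos (λ(θ₁ + θ₂)) ≤ T λ (cos (θ₁ + θ₂))` for `θ₁, θ₂ ∈ [0, π]`, `0 ≤ λ ≤ 1`
(equality when `θ₁ + θ₂ ≤ π`; when `θ₁ + θ₂ > π` the great-circle distance is `2π − θ₁ − θ₂` and
`λ ≤ 1` is used). -/
theorem cos_add_le_T {lam θ₁ θ₂ : ℝ} (h0 : 0 ≤ lam) (h1 : lam ≤ 1) (hθ₁ : θ₁ ∈ Icc 0 π)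
    (hθ₂ : θ₂ ∈ Icc 0 π) : cos (lam * θ₁ + lam * θ₂) ≤ T lam (cos (θ₁ + θ₂)) := by
  simp only [T]
  by_cases hle : θ₁ + θ₂ ≤ π
  · rw [arccos_cos (by linarith [hθ₁.1, hθ₂.1]) hle, mul_add]
  · push Not at hle
    have h2 : cos (θ₁ + θ₂) = cos (2 * π - (θ₁ + θ₂)) := by
      rw [cos_sub, cos_two_pi, sin_two_pi]; ring
    rw [h2, arccos_cos (by linarith [hθ₁.2, hθ₂.2]) (by linarith)]
    rw [show lam * θ₁ + lam * θ₂ = lam * (θ₁ + θ₂) by ring]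
    apply cos_le_cos_of_le_of_add_le
    · exact mul_nonneg h0 (by linarith [hθ₁.2, hθ₂.2])
    · exact mul_le_mul_of_nonneg_left (by linarith) h0
    · nlinarith [hθ₁.2, hθ₂.2, pi_pos]

/-- **THE POLAR CONTRACTION INEQUALITY** (Böröczky–Szabó; RANGE-CUT.md §2, calculus proof): for
polar angles `θ₁, θ₂ ∈ [0, π]` about a pole, a longitude cosine `c ∈ [-1, 1]`, and a contraction
factor `0 ≤ λ ≤ 1`, the inner product of the contracted directions is at most `cos` of `λ` times
the original angle:
`cos λθ₁ cos λθ₂ + sin λθ₁ sin λθ₂ c ≤ cos (λ · arccos (cos θ₁ cos θ₂ + sin θ₁ sin θ₂ c))`,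
i.e. `d(Cx, Cy) ≥ λ · d(x, y)`. Proof: the left side is affine in `c`, the right side concave in
`c` (`concaveOn_T`), and the inequality holds at `c = ±1` (`T_cos_sub`, `cos_add_le_T`). -/
theorem inner_contract_le {lam θ₁ θ₂ c : ℝ} (h0 : 0 ≤ lam) (h1 : lam ≤ 1) (hθ₁ : θ₁ ∈ Icc 0 π)
    (hθ₂ : θ₂ ∈ Icc 0 π) (hc : c ∈ Icc (-1 : ℝ) 1) :
    cos (lam * θ₁) * cos (lam * θ₂) + sin (lam * θ₁) * sin (lam * θ₂) * c ≤
      T lam (cos θ₁ * cos θ₂ + sin θ₁ * sin θ₂ * c) := by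
  -- the two endpoints of the segment, as points of [-1, 1]
  have hp1 : cos (θ₁ - θ₂) ∈ Icc (-1 : ℝ) 1 := ⟨neg_one_le_cos _, cos_le_one _⟩
  have hm1 : cos (θ₁ + θ₂) ∈ Icc (-1 : ℝ) 1 := ⟨neg_one_le_cos _, cos_le_one _⟩
  -- weights
  set a : ℝ := (1 - c) / 2 with ha
  set b : ℝ := (1 + c) / 2 with hb
  have ha0 : 0 ≤ a := by rw [ha]; linarith [hc.2]
  have hb0 : 0 ≤ b := by rw [hb]; linarith [hc.1]
  have hab : a + b = 1 := by rw [ha, hb]; ring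
  -- the argument is the convex combination of the endpoints
  have harg : cos θ₁ * cos θ₂ + sin θ₁ * sin θ₂ * c = a • cos (θ₁ + θ₂) + b • cos (θ₁ - θ₂) := by
    rw [smul_eq_mul, smul_eq_mul, cos_add, cos_sub, ha, hb]; ring
  have hconc := (concaveOn_T h0 h1).2 hm1 hp1 ha0 hb0 hab
  rw [← harg, smul_eq_mul, smul_eq_mul] at hconc
  -- the affine side at the endpoints
  have hlhs : cos (lam * θ₁) * cos (lam * θ₂) + sin (lam * θ₁) * sin (lam * θ₂) * c =
      a * cos (lam * θ₁ + lam * θ₂) + b * cos (lam * θ₁ - lam * θ₂) := by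
    rw [cos_add, cos_sub, ha, hb]; ring
  rw [hlhs]
  have e1 := T_cos_sub (lam := lam) hθ₁ hθ₂
  have e2 := cos_add_le_T h0 h1 hθ₁ hθ₂
  have : a * cos (lam * θ₁ + lam * θ₂) + b * cos (lam * θ₁ - lam * θ₂) ≤
      a * T lam (cos (θ₁ + θ₂)) + b * T lam (cos (θ₁ - θ₂)) := by
    rw [e1]
    nlinarith [mul_le_mul_of_nonneg_left e2 ha0]
  exact this.trans hconc

/-! ## Half-angle tangents: the contraction as a profile -/

/-- For `cos b ≠ 0`: `1 − tan² b = cos 2b · (1 + tan² b)`. -/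
theorem one_sub_tan_sq (b : ℝ) (hb : cos b ≠ 0) :
    1 - tan b ^ 2 = cos (2 * b) * (1 + tan b ^ 2) := by
  have h1 : 1 + tan b ^ 2 = (cos b ^ 2)⁻¹ := by rw [← inv_one_add_tan_sq hb, inv_inv]
  have hc2 : cos b ^ 2 ≠ 0 := pow_ne_zero 2 hb
  calc 1 - tan b ^ 2 = 2 - (1 + tan b ^ 2) := by ring
    _ = 2 - (cos b ^ 2)⁻¹ := by rw [h1]
    _ = (2 * cos b ^ 2 - 1) * (cos b ^ 2)⁻¹ := by field_simp
    _ = cos (2 * b) * (1 + tan b ^ 2) := by rw [cos_two_mul, h1]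

/-- For `cos b ≠ 0`: `2 tan b = sin 2b · (1 + tan² b)`. -/
theorem two_mul_tan (b : ℝ) (hb : cos b ≠ 0) : 2 * tan b = sin (2 * b) * (1 + tan b ^ 2) := by
  have h1 : 1 + tan b ^ 2 = (cos b ^ 2)⁻¹ := by rw [← inv_one_add_tan_sq hb, inv_inv]
  rw [h1, sin_two_mul, tan_eq_sin_div_cos]
  field_simp

/-- **The contraction profile in half-angle tangents**: `F w = tan (λ · arctan w)` for `w ≥ 0`
(`0` for `w < 0`): if `w = tan (θ/2)` then `F w = tan (λθ/2)`. -/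
def contractProfile (lam w : ℝ) : ℝ := tan (lam * arctan (max w 0))

/-- The profile vanishes at `0`. -/
theorem contractProfile_zero (lam : ℝ) : contractProfile lam 0 = 0 := by
  simp [contractProfile]

/-- The contracted half angle `λ · arctan (max w 0)` lies in `[0, π/2)` for `0 ≤ λ ≤ 1`. -/
theorem contract_angle_mem {lam : ℝ} (h0 : 0 ≤ lam) (h1 : lam ≤ 1) (w : ℝ) :
    0 ≤ lam * arctan (max w 0) ∧ lam * arctan (max w 0) < π / 2 := by
  have ha0 : 0 ≤ arctan (max w 0) := arctan_nonneg.2 (le_max_right _ _)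
  have ha1 : arctan (max w 0) < π / 2 := arctan_lt_pi_div_two _
  refine ⟨mul_nonneg h0 ha0, ?_⟩
  calc lam * arctan (max w 0) ≤ 1 * arctan (max w 0) := mul_le_mul_of_nonneg_right h1 ha0
    _ < π / 2 := by rw [one_mul]; exact ha1

/-- The profile is nonnegative (for `0 ≤ λ ≤ 1`). -/
theorem contractProfile_nonneg {lam : ℝ} (h0 : 0 ≤ lam) (h1 : lam ≤ 1) (w : ℝ) :
    0 ≤ contractProfile lam w := by
  obtain ⟨hb0, hb1⟩ := contract_angle_mem h0 h1 w
  exact tan_nonneg_of_nonneg_of_le_pi_div_two hb0 hb1.le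

/-- `arccos (1/2) = π/3`. -/
theorem arccos_one_half : arccos (1 / 2 : ℝ) = π / 3 := by
  rw [← cos_pi_div_three, arccos_cos (by positivity) (by linarith [pi_pos])]

end Summit.Ventures.Crystal3D.PolarContraction

end
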